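import Literature.NumberTheory.Sieve.PolymathGEHTupleLevelSums
import Literature.NumberTheory.Sieve.PolymathGEHToEH
import Literature.NumberTheory.Sieve.PolymathGEHPrimePieceLevel
import HarnessLib

/-!
# The level of distribution of the truncated inner sequence (§4.5, bound (local))

Trunk AntSieve, tooling toward the named fact `Literature.NumberTheory.Sieve.weakDHL_three_two_of_GEH`
(D. H. J. Polymath, Res. Math. Sci. 1:12 (2014) = arXiv:1407.4897, Theorem 3.2(xii)).

§4.5, p. 17: "`Σ_{q ≲ x^ϑ} sup_{a ∈ (ℤ/qℤ)^×} |Δ(1_{[x+h_k,2x+h_k]} λ_{F_k} λ_{G_k} 1_{p(·) > x^ε}; a (q))| ≪ x log^{-A} x`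
… by Claim 2.6 [GEH] … we partition … into `O(log^{A+1} x)` intervals … the contribution of
[the exceptional tuples] is acceptably small by trivial estimates."  This file feeds the fixed-`x`
machinery of `PolymathGEHTupleLevelSums.lean` with the two level inputs — the `GEH` family bound
`gehSum_primeTupleFamily_le` for tuples of `r ≥ 2` primes and the `EH`-type bound
`sum_iSup_apDiscrepancy_primePiece_le` for single primes (`EH` from `GEH`, Proposition 2.7,
`PolymathGEHToEH.lean`) — and performs the final bookkeeping in `x`:

* `isBigO_sum_iSup_apDiscrepancy_wTrunc` — assuming `GEH[ϑ]` for all `ϑ < 1`: for `F, G`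
  differentiable, bounded with bounded derivative, `0 < ε ≤ 1/2`, `0 < θ < 1` and every `A > 0`,
  `Σ_{q ≤ x^θ} sup_a |Δ(w_ε 1_{(X₁, X₂]}; a (q))| = O(x / log^A x)`.

## References

* [Polymath8b2014] D. H. J. Polymath, Res. Math. Sci. 1 (2014), Art. 12 = arXiv:1407.4897,
  §4.5, p. 17, (local); Claim 2.6; Proposition 2.7.
-/

noncomputable section

open Finset Filter Asymptotics Real
open scoped ArithmeticFunction.omega

namespace Literature.NumberTheory.Sieve

open scoped Classical

/-! ### Eventual facts about the grid -/

section Eventual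

/-- `log^{A₀} x = o(x^ε)`: eventually `(5/2) x^{-ε} ≤ (log x)^{-A₀}` etc.  Packaged: for `c > 0`,
eventually `c · (log x)^{A₀} ≤ x^ε`. [folklore] -/
theorem eventually_mul_log_rpow_le_rpow {ε : ℝ} (hε : 0 < ε) (A₀ c : ℝ) :
    ∀ᶠ x : ℝ in atTop, c * Real.log x ^ A₀ ≤ x ^ ε := by
  have h := isLittleO_log_rpow_rpow_atTop A₀ hε
  have h' := h.def (show (0 : ℝ) < 1 / (|c| + 1) by positivity)
  filter_upwards [h', eventually_ge_atTop (1 : ℝ)] with x hx hx1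
  have hlog : 0 ≤ Real.log x := Real.log_nonneg hx1
  rw [Real.norm_of_nonneg (Real.rpow_nonneg hlog _), Real.norm_of_nonneg (Real.rpow_nonneg (by linarith) _)] at hx
  have hxε : 0 ≤ x ^ ε := Real.rpow_nonneg (by linarith) _
  have h1 : c * Real.log x ^ A₀ ≤ (|c| + 1) * Real.log x ^ A₀ := by
    have := le_abs_self c
    exact mul_le_mul_of_nonneg_right (by linarith) (Real.rpow_nonneg hlog _)
  refine h1.trans ?_
  calc (|c| + 1) * Real.log x ^ A₀ ≤ (|c| + 1) * (1 / (|c| + 1) * x ^ ε) :=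
        mul_le_mul_of_nonneg_left hx (by positivity)
    _ = x ^ ε := by field_simp

variable {ε A₀ : ℝ}

/-- Eventually `ρ' - 1 ≤ 2 (log x)^{-A₀}` where `ρ' = ρ (1 + 2x^{-ε})`. [folklore] -/
theorem eventually_rho'_sub_one_le (hε : 0 < ε) (hA₀ : 2 ≤ A₀) :
    ∀ᶠ x : ℝ in atTop, gridRho A₀ x * (1 + 2 / x ^ ε) - 1 ≤ 2 * Real.log x ^ (-A₀) := by
  filter_upwards [eventually_mul_log_rpow_le_rpow hε A₀ (5 / 2), eventually_ge_atTop (Real.exp 2)]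
    with x hx hx2
  have hx0 : 0 < x := lt_of_lt_of_le (Real.exp_pos 2) hx2
  have hlog2 : 2 ≤ Real.log x := by rwa [Real.le_log_iff_exp_le hx0]
  have hlog0 : 0 < Real.log x := by linarith
  have hL : logFloor x = Real.log x := logFloor_eq_log hlog2
  have hρ1 : gridRho A₀ x - 1 = Real.log x ^ (-A₀) := by rw [gridRho_sub_one_eq, hL]
  have hρle : gridRho A₀ x ≤ 5 / 4 := gridRho_le hA₀ x
  have hxε : 0 < x ^ ε := Real.rpow_pos_of_pos hx0 ε
  have hLA : 0 < Real.log x ^ A₀ := Real.rpow_pos_of_pos hlog0 _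
  -- `2 ρ / x^ε ≤ (5/2) / x^ε ≤ (log x)^{-A₀}`
  have hkey : gridRho A₀ x * (2 / x ^ ε) ≤ Real.log x ^ (-A₀) := by
    rw [Real.rpow_neg hlog0.le, ← one_div, le_div_iff₀ hLA]
    calc gridRho A₀ x * (2 / x ^ ε) * Real.log x ^ A₀ = (2 * gridRho A₀ x) * (Real.log x ^ A₀ / x ^ ε) := by ring
      _ ≤ (5 / 2) * (Real.log x ^ A₀ / x ^ ε) :=
          mul_le_mul_of_nonneg_right (by linarith) (div_nonneg hLA.le hxε.le)
      _ = (5 / 2 * Real.log x ^ A₀) / x ^ ε := by ring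
      _ ≤ 1 := by rw [div_le_one hxε]; exact hx
  calc gridRho A₀ x * (1 + 2 / x ^ ε) - 1 = (gridRho A₀ x - 1) + gridRho A₀ x * (2 / x ^ ε) := by ring
    _ ≤ Real.log x ^ (-A₀) + Real.log x ^ (-A₀) := add_le_add hρ1.le hkey
    _ = 2 * Real.log x ^ (-A₀) := by ring

/-- Eventually `J + 1 ≤ 5 (log x)^{A₀ + 1}`. [folklore] -/
theorem eventually_gridJ_add_one_le (hA₀ : 0 ≤ A₀) :
    ∀ᶠ x : ℝ in atTop, (gridJ A₀ x : ℝ) + 1 ≤ 5 * Real.log x ^ (A₀ + 1) := by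
  filter_upwards [eventually_ge_atTop (Real.exp 2)] with x hx2
  have hx0 : 0 < x := lt_of_lt_of_le (Real.exp_pos 2) hx2
  have hlog2 : 2 ≤ Real.log x := by rwa [Real.le_log_iff_exp_le hx0]
  have hlog0 : 0 < Real.log x := by linarith
  have hL : logFloor x = Real.log x := logFloor_eq_log hlog2
  have hJ := gridJ_le hA₀ (show (1 : ℝ) ≤ x by linarith [Real.add_one_le_exp (2 : ℝ)])
  rw [hL] at hJ
  have hpow : Real.log x * Real.log x ^ A₀ = Real.log x ^ (A₀ + 1) := by
    rw [Real.rpow_add hlog0, Real.rpow_one]; ring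
  have h1 : (1 : ℝ) ≤ Real.log x ^ (A₀ + 1) := Real.one_le_rpow (by linarith) (by linarith)
  calc (gridJ A₀ x : ℝ) + 1 ≤ 4 * Real.log x * Real.log x ^ A₀ + 1 := by linarith
    _ = 4 * Real.log x ^ (A₀ + 1) + 1 := by rw [mul_assoc, hpow]
    _ ≤ 5 * Real.log x ^ (A₀ + 1) := by linarith

/-- `top τ ≤ 2^r bot τ` (any real `x`, `A₀ ≥ 2`). [folklore] -/
theorem boxTop_le_two_pow_mul_boxBot (hA₀ : 2 ≤ A₀) (x : ℝ) {r : ℕ} (τ : Fin r → ℕ) :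
    boxTop ε A₀ x τ ≤ 2 ^ r * boxBot ε A₀ x τ := by
  unfold boxTop boxBot
  calc ∏ i, gridAt ε A₀ x (τ i + 1) ≤ ∏ i, (2 * gridAt ε A₀ x (τ i)) :=
        Finset.prod_le_prod' fun i _ => gridAt_succ_le hA₀ x (τ i)
    _ = 2 ^ r * ∏ i, gridAt ε A₀ x (τ i) := by
        rw [Finset.prod_mul_distrib, Finset.prod_const, Finset.card_univ, Fintype.card_fin]

/-- `bot σ ≥ c_0 ^ s ≥ c_0` for `s ≥ 1` (the grid is monotone and `c_0 ≥ 1`). [folklore] -/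
theorem gridAt_zero_le_boxBot (x : ℝ) {s : ℕ} (hs : 1 ≤ s) (σ : Fin s → ℕ) :
    gridAt ε A₀ x 0 ≤ boxBot ε A₀ x σ := by
  unfold boxBot
  have hc : Monotone (gridAt ε A₀ x) := gridAt_mono ε A₀ x
  have h1 : ∀ i ∈ (Finset.univ : Finset (Fin s)), 1 ≤ gridAt ε A₀ x (σ i) := fun i _ =>
    le_trans (by norm_num) (three_le_gridAt ε A₀ x (σ i))
  obtain ⟨i₀⟩ : Nonempty (Fin s) := ⟨⟨0, hs⟩⟩
  calc gridAt ε A₀ x 0 ≤ gridAt ε A₀ x (σ i₀) := hc (Nat.zero_le _)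
    _ ≤ ∏ i, gridAt ε A₀ x (σ i) := Finset.single_le_prod' h1 (Finset.mem_univ i₀)

end Eventual

/-! ### Eventual power facts -/

section Powers

variable {ε : ℝ}

/-- The eventual power inequalities used for the scales (`0 < ε ≤ 1/2`): `3 ≤ x^ε`,
`x^{ε/4} ≤ x^ε - 1`, `3x/(x^ε - 1) ≤ x^{1-ε/4}`, `2 x^{1-ε/4} ≤ x`, and for `d = ⌊√x⌋`:
`x^{ε/4} ≤ d ≤ x^{1-ε/4}`, `d ≤ x`, `x/2 ≤ d² ≤ x`. [folklore] -/
theorem eventually_power_facts (hε : 0 < ε) (hε1 : ε ≤ 1 / 2) :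
    ∀ᶠ x : ℝ in atTop, 3 ≤ x ^ ε ∧ x ^ (ε / 4) ≤ x ^ ε - 1 ∧ 3 * x / (x ^ ε - 1) ≤ x ^ (1 - ε / 4) ∧
      2 * x ^ (1 - ε / 4) ≤ x ∧
      x ^ (ε / 4) ≤ (⌊Real.sqrt x⌋₊ : ℝ) ∧ (⌊Real.sqrt x⌋₊ : ℝ) ≤ x ^ (1 - ε / 4) ∧ (⌊Real.sqrt x⌋₊ : ℝ) ≤ x ∧
      x / 2 ≤ (⌊Real.sqrt x⌋₊ : ℝ) ^ 2 ∧ (⌊Real.sqrt x⌋₊ : ℝ) ^ 2 ≤ x := by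
  have t1 : Tendsto (fun x : ℝ => x ^ (3 * ε / 4)) atTop atTop := tendsto_rpow_atTop (by positivity)
  have t2 : Tendsto (fun x : ℝ => x ^ (ε / 4)) atTop atTop := tendsto_rpow_atTop (by positivity)
  have t3 : Tendsto (fun x : ℝ => x ^ (1 / 2 - ε / 4)) atTop atTop := tendsto_rpow_atTop (by linarith)
  filter_upwards [t1.eventually_ge_atTop 4, t2.eventually_ge_atTop 3, t3.eventually_ge_atTop 2,
    eventually_ge_atTop (16 : ℝ)] with x h1 h2 h3 hx16
  have hx0 : 0 < x := by linarith
  have hx1 : 1 ≤ x := by linarith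
  -- algebra of exponents
  have eε : x ^ ε = x ^ (ε / 4) * x ^ (3 * ε / 4) := by
    rw [← Real.rpow_add hx0]; congr 1; ring
  have e1 : x = x ^ (1 - ε / 4) * x ^ (ε / 4) := by
    rw [← Real.rpow_add hx0]; norm_num
  have hxε4 : 0 < x ^ (ε / 4) := by positivity
  have hx1ε : 0 < x ^ (1 - ε / 4) := by positivity
  have hA : 3 ≤ x ^ ε := by
    rw [eε]; nlinarith
  have hB : x ^ (ε / 4) ≤ x ^ ε - 1 := by
    rw [eε]; nlinarith
  have hC : 3 * x / (x ^ ε - 1) ≤ x ^ (1 - ε / 4) := by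
    rw [div_le_iff₀ (by linarith)]
    -- `3x = 3 x^{1-ε/4} x^{ε/4} ≤ x^{1-ε/4} (x^ε - 1)` as `x^ε - 1 ≥ x^{ε/4}(x^{3ε/4} - 1) ≥ 3 x^{ε/4}`
    have : 3 * x ^ (ε / 4) ≤ x ^ ε - 1 := by rw [eε]; nlinarith
    calc 3 * x = 3 * (x ^ (1 - ε / 4) * x ^ (ε / 4)) := by rw [← e1]
      _ = x ^ (1 - ε / 4) * (3 * x ^ (ε / 4)) := by ring
      _ ≤ x ^ (1 - ε / 4) * (x ^ ε - 1) := mul_le_mul_of_nonneg_left this hx1ε.le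
  have hD : 2 * x ^ (1 - ε / 4) ≤ x := by
    calc 2 * x ^ (1 - ε / 4) ≤ x ^ (ε / 4) * x ^ (1 - ε / 4) :=
          mul_le_mul_of_nonneg_right (by linarith) hx1ε.le
      _ = x := by rw [mul_comm, ← e1]
  -- the square root
  set d := ⌊Real.sqrt x⌋₊ with hd
  have hsq : Real.sqrt x ^ 2 = x := Real.sq_sqrt hx0.le
  have hs0 : 0 ≤ Real.sqrt x := Real.sqrt_nonneg x
  have hdle : (d : ℝ) ≤ Real.sqrt x := Nat.floor_le hs0
  have hdge : Real.sqrt x - 1 < d := by have := Nat.lt_floor_add_one (Real.sqrt x); rw [hd]; linarith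
  have hsqrt_eq : Real.sqrt x = x ^ (1 / 2 : ℝ) := Real.sqrt_eq_rpow x
  have hhalf : x ^ (1 / 2 : ℝ) = x ^ (1 / 2 - ε / 4) * x ^ (ε / 4) := by
    rw [← Real.rpow_add hx0]; norm_num
  have hs4 : 4 ≤ Real.sqrt x := by
    rw [show (4 : ℝ) = Real.sqrt 16 by rw [show (16 : ℝ) = 4 ^ 2 by norm_num, Real.sqrt_sq (by norm_num)]]
    exact Real.sqrt_le_sqrt hx16
  have hE : x ^ (ε / 4) ≤ (d : ℝ) := by
    -- `√x - 1 ≥ x^{ε/4}` as `√x = x^{1/2-ε/4} x^{ε/4} ≥ 2 x^{ε/4}` and `x^{ε/4} ≥ 1`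
    have : 2 * x ^ (ε / 4) ≤ Real.sqrt x := by
      rw [hsqrt_eq, hhalf]; exact mul_le_mul_of_nonneg_right h3 hxε4.le
    linarith
  have hF : (d : ℝ) ≤ x ^ (1 - ε / 4) := by
    refine hdle.trans ?_
    rw [hsqrt_eq]
    exact Real.rpow_le_rpow_of_exponent_le hx1 (by linarith)
  have hG : (d : ℝ) ≤ x := by
    refine hdle.trans ?_
    rw [hsqrt_eq]
    calc x ^ (1 / 2 : ℝ) ≤ x ^ (1 : ℝ) := Real.rpow_le_rpow_of_exponent_le hx1 (by norm_num)
      _ = x := Real.rpow_one x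
  have hH : x / 2 ≤ (d : ℝ) ^ 2 := by
    have h0 : 0 ≤ Real.sqrt x - 1 := by linarith
    have : (Real.sqrt x - 1) ^ 2 ≤ (d : ℝ) ^ 2 := by
      exact pow_le_pow_left₀ h0 hdge.le 2
    nlinarith
  have hI : (d : ℝ) ^ 2 ≤ x := by
    calc (d : ℝ) ^ 2 ≤ Real.sqrt x ^ 2 := pow_le_pow_left₀ (Nat.cast_nonneg _) hdle 2
      _ = x := hsq
  exact ⟨hA, hB, hC, hD, hE, hF, hG, hH, hI⟩

end Powers

/-! ### The scales of the relevant tuples -/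

section Scales

variable {ε A₀ : ℝ} {h₀ : ℤ}

/-- `bot τ = bot (τ ∘ castSucc) · c_{τ last}`. [folklore] -/
theorem boxBot_succ (x : ℝ) {s : ℕ} (τ : Fin (s + 1) → ℕ) :
    boxBot ε A₀ x τ = boxBot ε A₀ x (fun j : Fin s => τ j.castSucc) * gridAt ε A₀ x (τ (Fin.last s)) := by
  unfold boxBot; exact Fin.prod_univ_castSucc _

/-- **The scales of a relevant tuple** (`s ≥ 1` pieces below the last one), eventually in `x`:
with `B = bot (τ ∘ castSucc)`, `m = c_{τ last}`: `x^{ε/4} ≤ m ≤ x^{1-ε/4}`, `c_{τ last+1} ≤ x`,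
`x^{ε/4} ≤ B ≤ x^{1-ε/4}`, `x/2^{s+2} ≤ B m ≤ 3x`. [cite: Polymath8b2014, §4.5, p. 17] -/
theorem eventually_rel_scales (hε : 0 < ε) (hε1 : ε ≤ 1 / 2) (hA₀ : 2 ≤ A₀) (h₀ : ℤ) {s : ℕ} (hs : 1 ≤ s) :
    ∀ᶠ x : ℝ in atTop, ∀ τ ∈ relTuples ε A₀ h₀ x s,
      x ^ (ε / 4) ≤ (gridAt ε A₀ x (τ (Fin.last s)) : ℝ) ∧
      (gridAt ε A₀ x (τ (Fin.last s)) : ℝ) ≤ x ^ (1 - ε / 4) ∧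
      (gridAt ε A₀ x (τ (Fin.last s) + 1) : ℝ) ≤ x ∧
      x ^ (ε / 4) ≤ (boxBot ε A₀ x (fun j : Fin s => τ j.castSucc) : ℝ) ∧
      (boxBot ε A₀ x (fun j : Fin s => τ j.castSucc) : ℝ) ≤ x ^ (1 - ε / 4) ∧
      x / 2 ^ (s + 2) ≤ (boxBot ε A₀ x (fun j : Fin s => τ j.castSucc) : ℝ) * gridAt ε A₀ x (τ (Fin.last s)) ∧
      (boxBot ε A₀ x (fun j : Fin s => τ j.castSucc) : ℝ) * gridAt ε A₀ x (τ (Fin.last s)) ≤ 2 ^ (s + 2) * x := by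
  filter_upwards [eventually_power_facts hε hε1, eventually_ge_atTop (4 : ℝ),
    eventually_ge_atTop (2 * ((h₀.natAbs : ℝ) + 2))] with x hpow hx4 hxh τ hτ
  obtain ⟨h3ε, hB1, hC1, hD1, -, -, -, -, -⟩ := hpow
  have hx0 : 0 < x := by linarith
  have hxh' : (h₀.natAbs : ℝ) + 2 ≤ x := by
    have : (0 : ℝ) ≤ h₀.natAbs := Nat.cast_nonneg _; linarith
  obtain ⟨-, -, hX₁lo, -, -, hX₂hi, -, -⟩ := thetaX_bounds h₀ hxh'
  have habs : ((h₀.natAbs : ℕ) : ℝ) = |(h₀ : ℝ)| := by rw [Nat.cast_natAbs, Int.cast_abs]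
  have hh1 : -(h₀ : ℝ) ≤ h₀.natAbs := by rw [habs]; exact neg_le_abs _
  have hh2 : (h₀ : ℝ) ≤ h₀.natAbs := by rw [habs]; exact le_abs_self _
  have hX₁ : x / 2 ≤ (thetaX1 h₀ x : ℝ) := by linarith
  have hX₂ : (thetaX2 h₀ x : ℝ) ≤ 3 * x := by linarith
  set c := gridAt ε A₀ x with hcdef
  have hc : Monotone c := gridAt_mono ε A₀ x
  set σ : Fin s → ℕ := fun j => τ j.castSucc
  set B := boxBot ε A₀ x σ with hBdef
  set m := c (τ (Fin.last s)) with hmdef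
  obtain ⟨hrel1, hrel2⟩ := (Finset.mem_filter.1 hτ).2
  -- `bot τ = B m`, `top τ ≤ 2^{s+1} bot τ`
  have hbot : (boxBot ε A₀ x τ : ℝ) = (B : ℝ) * m := by
    rw [boxBot_succ x τ]; push_cast; rfl
  have htop : (boxTop ε A₀ x τ : ℝ) ≤ 2 ^ (s + 1) * ((B : ℝ) * m) := by
    rw [← hbot]; exact_mod_cast boxTop_le_two_pow_mul_boxBot hA₀ x τ
  have hBm_hi : (B : ℝ) * m < thetaX2 h₀ x := by rw [← hbot]; exact_mod_cast hrel1
  have hBm_lo : (thetaX1 h₀ x : ℝ) < 2 ^ (s + 1) * ((B : ℝ) * m) :=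
    lt_of_lt_of_le (by exact_mod_cast hrel2) htop
  -- `c_0 > x^ε - 1 ≥ x^{ε/4}`
  have hc0 : x ^ ε - 1 < (c 0 : ℝ) := by
    have := real_lt_gridAt ε A₀ x 0; rwa [pow_zero, mul_one] at this
  have hm_lo : x ^ ε - 1 < (m : ℝ) := lt_of_lt_of_le hc0 (by exact_mod_cast hc (Nat.zero_le _))
  have hB_lo : x ^ ε - 1 < (B : ℝ) :=
    lt_of_lt_of_le hc0 (by exact_mod_cast gridAt_zero_le_boxBot x hs σ)
  have hxε1 : 0 < x ^ ε - 1 := by linarith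
  have hm0 : (0 : ℝ) < m := by linarith [Real.rpow_nonneg hx0.le (ε / 4)]
  have hB0 : (0 : ℝ) < B := by linarith [Real.rpow_nonneg hx0.le (ε / 4)]
  have hBm3 : (B : ℝ) * m ≤ 3 * x := by linarith
  -- upper bounds via `B m ≤ 3x`
  have hm_hi : (m : ℝ) ≤ x ^ (1 - ε / 4) := by
    have h1 : (m : ℝ) ≤ 3 * x / (x ^ ε - 1) := by
      rw [le_div_iff₀ hxε1]
      calc (m : ℝ) * (x ^ ε - 1) ≤ m * B := mul_le_mul_of_nonneg_left hB_lo.le hm0.le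
        _ = B * m := mul_comm _ _
        _ ≤ 3 * x := hBm3
    exact h1.trans hC1
  have hB_hi : (B : ℝ) ≤ x ^ (1 - ε / 4) := by
    have h1 : (B : ℝ) ≤ 3 * x / (x ^ ε - 1) := by
      rw [le_div_iff₀ hxε1]
      calc (B : ℝ) * (x ^ ε - 1) ≤ B * m := mul_le_mul_of_nonneg_left hm_lo.le hB0.le
        _ ≤ 3 * x := hBm3
    exact h1.trans hC1
  have hm' : (c (τ (Fin.last s) + 1) : ℝ) ≤ x := by
    have h1 : (c (τ (Fin.last s) + 1) : ℝ) ≤ 2 * m := by exact_mod_cast gridAt_succ_le hA₀ x _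
    linarith
  have hlow : x / 2 ^ (s + 2) ≤ (B : ℝ) * m := by
    rw [div_le_iff₀ (by positivity), pow_succ]
    nlinarith
  have h2s : (3 : ℝ) ≤ 2 ^ (s + 2) := by
    calc (3 : ℝ) ≤ 2 ^ 2 := by norm_num
      _ ≤ 2 ^ (s + 2) := pow_le_pow_right₀ (by norm_num) (by omega)
  exact ⟨hB1.trans hm_lo.le, hm_hi, hm', hB1.trans hB_lo.le, hB_hi, hlow, hBm3.trans (by nlinarith)⟩

end Scales

/-! ### The `GEH` family bound for tuples of `r ≥ 2` primes -/

section Family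

variable {ε A₀ : ℝ} {h₀ : ℤ}

/-- An enumeration of the relevant tuples of order `s` at `x` (junk `0` beyond the count). [folklore] -/
def relEnum (ε A₀ : ℝ) (h₀ : ℤ) (x : ℝ) (s i : ℕ) : Fin (s + 1) → ℕ :=
  if h : i < (relTuples ε A₀ h₀ x s).card then ((relTuples ε A₀ h₀ x s).equivFin.symm ⟨i, h⟩).1
  else fun _ => 0

/-- Enumerated tuples are relevant tuples. [folklore] -/
theorem relEnum_mem {x : ℝ} {s i : ℕ} (h : i < (relTuples ε A₀ h₀ x s).card) :
    relEnum ε A₀ h₀ x s i ∈ relTuples ε A₀ h₀ x s := by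
  rw [relEnum, dif_pos h]; exact Finset.coe_mem _

/-- The enumeration is onto the relevant tuples. [folklore] -/
theorem exists_relEnum_eq {x : ℝ} {s : ℕ} {τ : Fin (s + 1) → ℕ} (hτ : τ ∈ relTuples ε A₀ h₀ x s) :
    ∃ i, i < (relTuples ε A₀ h₀ x s).card ∧ relEnum ε A₀ h₀ x s i = τ := by
  set e := (relTuples ε A₀ h₀ x s).equivFin
  refine ⟨e ⟨τ, hτ⟩, (e ⟨τ, hτ⟩).2, ?_⟩
  rw [relEnum, dif_pos (e ⟨τ, hτ⟩).2, Fin.eta, Equiv.symm_apply_apply]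

/-- The family data: last scale `m`. [folklore] -/
def famM (ε A₀ : ℝ) (h₀ : ℤ) (s : ℕ) (x : ℝ) (i : ℕ) : ℕ :=
  if i < (relTuples ε A₀ h₀ x s).card then gridAt ε A₀ x (relEnum ε A₀ h₀ x s i (Fin.last s))
  else ⌊Real.sqrt x⌋₊

/-- The family data: last upper scale `m'`. [folklore] -/
def famM' (ε A₀ : ℝ) (h₀ : ℤ) (s : ℕ) (x : ℝ) (i : ℕ) : ℕ :=
  if i < (relTuples ε A₀ h₀ x s).card then gridAt ε A₀ x (relEnum ε A₀ h₀ x s i (Fin.last s) + 1)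
  else ⌊Real.sqrt x⌋₊

/-- The family data: the scale `Nα` of the product of the first `s` primes. [folklore] -/
def famN (ε A₀ : ℝ) (h₀ : ℤ) (s : ℕ) (x : ℝ) (i : ℕ) : ℕ :=
  if i < (relTuples ε A₀ h₀ x s).card then boxBot ε A₀ x (fun j : Fin s => relEnum ε A₀ h₀ x s i j.castSucc)
  else ⌊Real.sqrt x⌋₊

/-- The family data: the pieces of the first `s` primes. [folklore] -/
def famPs (ε A₀ : ℝ) (h₀ : ℤ) (s : ℕ) (x : ℝ) (i : ℕ) : List (Finset ℕ) :=
  if i < (relTuples ε A₀ h₀ x s).card then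
    tuplePieces (gridAt ε A₀ x) (fun j : Fin s => relEnum ε A₀ h₀ x s i j.castSucc)
  else [∅]

/-- **The `GEH` family bound for the relevant tuples of order `s ≥ 1`**: assuming `GEH[θ]`, for every
`A' > 0`, eventually in `x`, for every relevant `τ`,
`Σ_{q ≤ x^θ} sup_a |Δ(Conv_τ; top τ; a (q))| ≤ C x / log^{A'} x`. [cite: Polymath8b2014, §4.5, p. 17, Claim 2.6] -/
theorem geh_bound_rel {θ : ℝ} (hGEH : GeneralizedElliottHalberstam θ) (hε : 0 < ε) (hε1 : ε ≤ 1 / 2)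
    (hA₀ : 2 ≤ A₀) (h₀ : ℤ) {s : ℕ} (hs : 1 ≤ s) {A' : ℝ} (hA' : 0 < A') :
    ∃ C : ℝ, ∀ᶠ x : ℝ in atTop, ∀ τ ∈ relTuples ε A₀ h₀ x s,
      ∑ q ∈ Icc 1 ⌊x ^ θ⌋₊, (⨆ a : (ZMod q)ˣ,
        |apDiscrepancy (tupleConv (gridAt ε A₀ x) τ) (boxTop ε A₀ x τ) q a|) ≤ C * (x / Real.log x ^ A') := by
  have hε4 : 0 < ε / 4 := by positivity
  have hC₁ : (1 : ℝ) ≤ 2 ^ (s + 2) := one_le_pow₀ (by norm_num)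
  have hsupp : ∀ x i, ∀ n ∈ tupleProducts (famPs ε A₀ h₀ s x i),
      famN ε A₀ h₀ s x i < n ∧ n ≤ 2 ^ s * famN ε A₀ h₀ s x i := by
    intro x i n hn
    by_cases hi : i < (relTuples ε A₀ h₀ x s).card
    · simp only [famPs, famN, if_pos hi] at hn ⊢
      refine ⟨prod_lt_of_mem_tupleProducts (c := gridAt ε A₀ x) hs hn, ?_⟩
      exact (le_prod_of_mem_tupleProducts (c := gridAt ε A₀ x) hn).trans
        (boxTop_le_two_pow_mul_boxBot hA₀ x _)
    · simp only [famPs, if_neg hi, tupleProducts_cons, Finset.mem_image, Finset.mem_product,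
        Finset.notMem_empty, and_false, false_and, exists_false] at hn
  have hβ : ∀ x i, famM ε A₀ h₀ s x i ≤ famM' ε A₀ h₀ s x i ∧ famM' ε A₀ h₀ s x i ≤ 2 * famM ε A₀ h₀ s x i := by
    intro x i
    by_cases hi : i < (relTuples ε A₀ h₀ x s).card
    · simp only [famM, famM', if_pos hi]
      exact ⟨gridAt_mono ε A₀ x (Nat.le_succ _), gridAt_succ_le hA₀ x _⟩
    · simp only [famM, famM', if_neg hi]
      omega
  have hscales : ∀ᶠ x : ℝ in atTop, ∀ i < (relTuples ε A₀ h₀ x s).card + 1,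
      x ^ (ε / 4) ≤ (famM ε A₀ h₀ s x i : ℝ) ∧ (famM ε A₀ h₀ s x i : ℝ) ≤ x ^ (1 - ε / 4) ∧
      (famM' ε A₀ h₀ s x i : ℝ) ≤ x ∧
      x ^ (ε / 4) ≤ (famN ε A₀ h₀ s x i : ℝ) ∧ (famN ε A₀ h₀ s x i : ℝ) ≤ x ^ (1 - ε / 4) ∧
      x / 2 ^ (s + 2) ≤ (famN ε A₀ h₀ s x i : ℝ) * famM ε A₀ h₀ s x i ∧
      (famN ε A₀ h₀ s x i : ℝ) * famM ε A₀ h₀ s x i ≤ 2 ^ (s + 2) * x := by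
    filter_upwards [eventually_rel_scales hε hε1 hA₀ h₀ hs, eventually_power_facts hε hε1]
      with x hrel hpow i hi
    by_cases hi' : i < (relTuples ε A₀ h₀ x s).card
    · simp only [famM, famM', famN, if_pos hi']
      obtain ⟨a1, a2, a3, a4, a5, a6, a7⟩ := hrel _ (relEnum_mem hi')
      exact ⟨a1, a2, a3, a4, a5, a6, a7⟩
    · simp only [famM, famM', famN, if_neg hi']
      obtain ⟨-, -, -, -, b1, b2, b3, b4, b5⟩ := hpow
      have h2 : (2 : ℝ) ≤ 2 ^ (s + 2) := by
        calc (2 : ℝ) = 2 ^ 1 := by norm_num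
          _ ≤ 2 ^ (s + 2) := pow_le_pow_right₀ (by norm_num) (by omega)
      have hx0 : 0 ≤ x := le_trans (by positivity) b5
      refine ⟨b1, b2, b3, b1, b2, ?_, ?_⟩
      · rw [div_le_iff₀ (by positivity), ← sq]
        nlinarith
      · rw [← sq]; nlinarith
  obtain ⟨C, hC⟩ := gehSum_primeTupleFamily_le hGEH hε4 hA' hs
    (fun x => (relTuples ε A₀ h₀ x s).card + 1) (Eventually.of_forall fun x => Nat.succ_pos _)
    (famM ε A₀ h₀ s) (famM' ε A₀ h₀ s) (famN ε A₀ h₀ s) (famPs ε A₀ h₀ s) hsupp hβ hC₁ hscales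
  refine ⟨C, ?_⟩
  filter_upwards [hC] with x hx τ hτ
  obtain ⟨i, hi, hiτ⟩ := exists_relEnum_eq hτ
  have h := hx i (by omega)
  simp only [famM, famM', famN, famPs, if_pos hi, hiτ] at h
  -- identify the `gehSum` with `S_τ`
  set c := gridAt ε A₀ x with hcdef
  have hαβ : setIndicatorAF (tupleProducts (tuplePieces c fun j : Fin s => τ j.castSucc)) *
      primePiece (c (τ (Fin.last s))) (c (τ (Fin.last s) + 1)) = tupleConv c τ := by
    rw [tupleConv, ← setIndicatorAF_primesIoc]; rfl
  have hcut : ⌊(2 : ℝ) ^ s * 2 ^ s * ((boxBot ε A₀ x (fun j : Fin s => τ j.castSucc) : ℝ) * (c (τ (Fin.last s)) : ℝ))⌋₊ =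
      4 ^ s * boxBot ε A₀ x τ := by
    rw [boxBot_succ x τ, show (4 : ℕ) ^ s = 2 ^ s * 2 ^ s by rw [← mul_pow]; norm_num]
    have : (2 : ℝ) ^ s * 2 ^ s * ((boxBot ε A₀ x (fun j : Fin s => τ j.castSucc) : ℝ) * (c (τ (Fin.last s)) : ℝ)) =
        ((2 ^ s * 2 ^ s * (boxBot ε A₀ x (fun j : Fin s => τ j.castSucc) * c (τ (Fin.last s))) : ℕ) : ℝ) := by
      push_cast; ring
    rw [this, Nat.floor_natCast]
  have hsupp : ∀ n, boxTop ε A₀ x τ < n → tupleConv c τ n = 0 := fun n hn => tupleConv_eq_zero_of_lt c τ hn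
  have hle : boxTop ε A₀ x τ ≤ 4 ^ s * boxBot ε A₀ x τ := by
    refine (boxTop_le_two_pow_mul_boxBot hA₀ x τ).trans (Nat.mul_le_mul_right _ ?_)
    have h2s : 2 ≤ 2 ^ s := by
      calc 2 = 2 ^ 1 := (pow_one 2).symm
        _ ≤ 2 ^ s := Nat.pow_le_pow_right (by norm_num) hs
    calc 2 ^ (s + 1) = 2 ^ s * 2 := pow_succ 2 s
      _ ≤ 2 ^ s * 2 ^ s := Nat.mul_le_mul_left _ h2s
      _ = 4 ^ s := by rw [← mul_pow]; norm_num
  rw [gehSum, hcut] at h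
  simp only [hαβ] at h
  convert h using 4 with q _ a
  exact congrArg abs (apDiscrepancy_eq_of_support hsupp hle q a).symm

end Family

/-! ### The `EH` bound for single primes (`s = 0`) -/

section Single

variable {ε A₀ : ℝ} {h₀ : ℤ}

/-- `1_{{1}} = 1` (the Dirichlet identity). [folklore] -/
theorem setIndicatorAF_singleton_one : setIndicatorAF ({1} : Finset ℕ) = (1 : ArithmeticFunction ℝ) := by
  ext n
  rw [setIndicatorAF_apply, ArithmeticFunction.one_apply]
  by_cases h : n = 1
  · rw [if_pos ⟨Finset.mem_singleton.2 h, by omega⟩, if_pos h]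
  · rw [if_neg (fun h' => h (Finset.mem_singleton.1 h'.1)), if_neg h]

/-- For a single piece the majorant is the prime piece itself. [folklore] -/
theorem tupleConv_fin_one (c : ℕ → ℕ) (τ : Fin 1 → ℕ) :
    tupleConv c τ = primePiece (c (τ 0)) (c (τ 0 + 1)) := by
  rw [tupleConv, ← setIndicatorAF_primesIoc]
  have h0 : tuplePieces c (fun i : Fin 0 => τ i.castSucc) = [] := by simp [tuplePieces]
  rw [h0, show tupleProducts [] = ({1} : Finset ℕ) from rfl, setIndicatorAF_singleton_one, one_mul]
  rfl

/-- **The `EH` bound for the relevant single pieces**: assuming `GEH[ϑ]` for all `ϑ < 1` (hence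
`EH[θ']` for `θ < θ' < 1`, Proposition 2.7), for every `A' > 0`, eventually in `x`, for every relevant
`τ : Fin 1 → ℕ`, `Σ_{q ≤ x^θ} sup_a |Δ(Conv_τ; top τ)| ≤ C x / log^{A'} x`. [cite: Polymath8b2014, §4.5, p. 17, Prop. 2.7] -/
theorem eh_bound_rel0 (hGEH : ∀ ϑ : ℝ, 0 < ϑ → ϑ < 1 → GeneralizedElliottHalberstam ϑ)
    (hA₀ : 2 ≤ A₀) (h₀ : ℤ) {θ : ℝ} (hθ1 : θ < 1) {A' : ℝ} (hA' : 0 < A') :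
    ∃ C : ℝ, ∀ᶠ x : ℝ in atTop, ∀ τ ∈ relTuples ε A₀ h₀ x 0,
      ∑ q ∈ Icc 1 ⌊x ^ θ⌋₊, (⨆ a : (ZMod q)ˣ,
        |apDiscrepancy (tupleConv (gridAt ε A₀ x) τ) (boxTop ε A₀ x τ) q a|) ≤ C * (x / Real.log x ^ A') := by
  set θ' : ℝ := (θ + 1) / 2 with hθ'
  have hθθ' : θ < θ' := by rw [hθ']; linarith
  have hθ'1 : θ' < 1 := by rw [hθ']; linarith
  have hpi : PrimesHaveLevelPi θ' :=
    (primesHaveLevel_iff_primesHaveLevelPi_holds θ').1 (GEHtoEH.primesHaveLevel_of_forall_geh hGEH hθ'1)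
  obtain ⟨C, hC⟩ := sum_iSup_apDiscrepancy_primePiece_le hθθ' hθ1 hpi hA'
  have h6 : Tendsto (fun x : ℝ => 6 * x) atTop atTop := tendsto_id.const_mul_atTop (by norm_num)
  refine ⟨6 * max C 0, ?_⟩
  filter_upwards [h6.eventually hC, eventually_ge_atTop ((h₀.natAbs : ℝ) + 2), eventually_ge_atTop (Real.exp 1)]
    with x hx hxh hxe τ hτ
  have hx0 : 0 < x := lt_of_lt_of_le (Real.exp_pos 1) hxe
  have hlog1 : 1 ≤ Real.log x := by rwa [Real.le_log_iff_exp_le hx0]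
  have hlog0 : 0 < Real.log x := by linarith
  obtain ⟨-, -, hX₂3⟩ := thetaX_sizes h₀ hxh
  set c := gridAt ε A₀ x with hcdef
  set j := τ 0 with hj
  obtain ⟨hrel1, -⟩ := (Finset.mem_filter.1 hτ).2
  have hbot : boxBot ε A₀ x τ = c j := by unfold boxBot; rw [Fin.prod_univ_one]
  have htop : boxTop ε A₀ x τ = c (j + 1) := by unfold boxTop; rw [Fin.prod_univ_one]
  have hm1 : 1 ≤ c j := le_trans (by norm_num) (three_le_gridAt ε A₀ x j)
  have hmm' : c j ≤ c (j + 1) := gridAt_mono ε A₀ x (Nat.le_succ j)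
  have hm'2 : c (j + 1) ≤ 2 * c j := gridAt_succ_le hA₀ x j
  have hm'x : (c (j + 1) : ℝ) ≤ 6 * x := by
    have h1 : (c j : ℝ) < thetaX2 h₀ x := by rw [← hbot]; exact_mod_cast hrel1
    have h2 : (c (j + 1) : ℝ) ≤ 2 * c j := by exact_mod_cast hm'2
    linarith
  have h := hx (c j) (c (j + 1)) (c (j + 1)) hm1 hmm' hm'x le_rfl
  rw [tupleConv_fin_one, htop]
  -- enlarge the range of moduli from `x^θ` to `(6x)^θ`
  have hθ0' : 0 ≤ θ ∨ θ < 0 := le_or_gt 0 θ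
  have hsub : Icc 1 ⌊x ^ θ⌋₊ ⊆ Icc 1 ⌊(6 * x) ^ θ⌋₊ ∨ θ < 0 := by
    rcases hθ0' with h0 | h0
    · left
      exact Finset.Icc_subset_Icc_right (Nat.floor_le_floor
        (Real.rpow_le_rpow hx0.le (by linarith) h0))
    · right; exact h0
  have hterm0 : ∀ q, 0 ≤ ⨆ a : (ZMod q)ˣ, |apDiscrepancy (fun n => (primePiece (c j) (c (j + 1)) n : ℝ)) (c (j + 1)) q a| :=
    fun q => Real.iSup_nonneg fun _ => abs_nonneg _
  have hlog6 : Real.log x ≤ Real.log (6 * x) := Real.log_le_log hx0 (by linarith)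
  have hrhs : C * (6 * x) / Real.log (6 * x) ^ A' ≤ 6 * max C 0 * (x / Real.log x ^ A') := by
    have hL6 : 0 < Real.log (6 * x) ^ A' := Real.rpow_pos_of_pos (by linarith) _
    have hL : 0 < Real.log x ^ A' := Real.rpow_pos_of_pos hlog0 _
    have hpow : Real.log x ^ A' ≤ Real.log (6 * x) ^ A' := Real.rpow_le_rpow hlog0.le hlog6 hA'.le
    calc C * (6 * x) / Real.log (6 * x) ^ A' ≤ max C 0 * (6 * x) / Real.log (6 * x) ^ A' := by
          gcongr; exact le_max_left _ _
      _ ≤ max C 0 * (6 * x) / Real.log x ^ A' :=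
          div_le_div_of_nonneg_left (by positivity) hL hpow
      _ = 6 * max C 0 * (x / Real.log x ^ A') := by ring
  rcases hsub with hsub | hneg
  · calc ∑ q ∈ Icc 1 ⌊x ^ θ⌋₊, (⨆ a : (ZMod q)ˣ, |apDiscrepancy (primePiece (c j) (c (j + 1))) (c (j + 1)) q a|)
        ≤ ∑ q ∈ Icc 1 ⌊(6 * x) ^ θ⌋₊, (⨆ a : (ZMod q)ˣ,
            |apDiscrepancy (fun n => (primePiece (c j) (c (j + 1)) n : ℝ)) (c (j + 1)) q a|) :=
          Finset.sum_le_sum_of_subset_of_nonneg hsub fun q _ _ => hterm0 q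
      _ ≤ C * (6 * x) / Real.log (6 * x) ^ A' := h
      _ ≤ 6 * max C 0 * (x / Real.log x ^ A') := hrhs
  · -- `θ < 0`: the range of moduli is empty
    have hempty : ⌊x ^ θ⌋₊ = 0 := by
      refine Nat.floor_eq_zero.2 ?_
      exact Real.rpow_lt_one_of_one_lt_of_neg (by linarith [Real.add_one_le_exp (1 : ℝ)]) hneg
    rw [hempty]
    simp only [show Icc 1 0 = (∅ : Finset ℕ) from rfl, Finset.sum_empty]
    positivity

end Single

/-! ### Numeric lemmas for the final bookkeeping -/

section Numeric

/-- `a^n - 1 ≤ n a^n (a - 1)` for `a ≥ 1`. [folklore] -/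
theorem pow_sub_one_le_mul {a : ℝ} (ha : 1 ≤ a) : ∀ n : ℕ, a ^ n - 1 ≤ n * a ^ n * (a - 1)
  | 0 => by simp
  | n + 1 => by
    have ih := pow_sub_one_le_mul ha n
    have han : 1 ≤ a ^ n * a := by rw [← pow_succ]; exact one_le_pow₀ ha
    have h1 := mul_le_mul_of_nonneg_left ih (by linarith : (0 : ℝ) ≤ a)
    have h2 := mul_le_mul_of_nonneg_left han (by linarith : (0 : ℝ) ≤ a - 1)
    push_cast
    rw [pow_succ]
    nlinarith [h1, h2]

/-- `#(filter (p ∨ q ∨ r)) ≤ #(filter p) + #(filter q) + #(filter r)`. [folklore] -/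
theorem card_filter_or_or_le {α : Type*} (s : Finset α) (p q r : α → Prop) [DecidablePred p]
    [DecidablePred q] [DecidablePred r] :
    (s.filter fun a => p a ∨ q a ∨ r a).card ≤ (s.filter p).card + (s.filter q).card + (s.filter r).card := by
  rw [Finset.filter_or, Finset.filter_or]
  exact (Finset.card_union_le _ _).trans (Nat.add_le_add_left (Finset.card_union_le _ _) _ |>.trans
    (by omega))

variable {L : ℝ}

/-- `Σ_{q ≤ Q} 1/φ(q) ≤ 4 L²` when `1 + log Q ≤ 2L`. [folklore] -/
theorem sum_inv_totient_le {Q : ℕ} (hL : 1 + Real.log Q ≤ 2 * L) (hL0 : 0 ≤ 1 + Real.log Q) :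
    ∑ q ∈ Icc 1 Q, (1 : ℝ) / Nat.totient q ≤ 4 * L ^ 2 := by
  refine (sum_Icc_one_div_totient_le_sq Q).trans ?_
  nlinarith

/-- The size of `η_s`: `0 ≤ η_s ≤ min(1, 2 ηB L^{-(A₀+1)})`. [folklore] -/
theorem eta_bounds {M D L ρ' A₀ : ℝ} {R₀ s : ℕ} (hM : 0 ≤ M) (hD : 0 ≤ D) (hL : 0 < L) (hsR : s + 1 ≤ R₀)
    (hρ'1 : 1 ≤ ρ') (hρ' : ρ' - 1 ≤ 2 * L ^ (-A₀))
    (hsmall : 2 * (2 * 4 ^ R₀ * M * D * R₀) + 1 ≤ L ^ (A₀ + 1)) :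
    0 ≤ 2 * 4 ^ (s + 1) * M * D * (s + 1) * ((ρ' - 1) / L) ∧
      2 * 4 ^ (s + 1) * M * D * (s + 1) * ((ρ' - 1) / L) ≤ 1 ∧
      2 * 4 ^ (s + 1) * M * D * (s + 1) * ((ρ' - 1) / L) ≤
        2 * (2 * 4 ^ R₀ * M * D * R₀) * L ^ (-(A₀ + 1)) := by
  set ηB : ℝ := 2 * 4 ^ R₀ * M * D * R₀ with hηB
  have hsR' : (s : ℝ) + 1 ≤ R₀ := by exact_mod_cast hsR
  have h4 : (4 : ℝ) ^ (s + 1) ≤ 4 ^ R₀ := pow_le_pow_right₀ (by norm_num) hsR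
  have hfrac0 : 0 ≤ (ρ' - 1) / L := div_nonneg (by linarith) hL.le
  have hfrac : (ρ' - 1) / L ≤ 2 * L ^ (-A₀) / L := div_le_div_of_nonneg_right hρ' hL.le
  have hLA₀1 : L ^ (-A₀) / L = L ^ (-(A₀ + 1)) := by
    rw [show -(A₀ + 1) = -A₀ + (-1) by ring, Real.rpow_add hL, Real.rpow_neg_one, div_eq_mul_inv]
  have hcoef : 2 * 4 ^ (s + 1) * M * D * (s + 1) ≤ ηB := by
    rw [hηB]
    have hMD : 0 ≤ M * D := mul_nonneg hM hD
    have e1 : 2 * 4 ^ (s + 1) * M * D * ((s : ℝ) + 1) = (2 * (M * D)) * (4 ^ (s + 1) * ((s : ℝ) + 1)) := by ring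
    have e2 : 2 * 4 ^ R₀ * M * D * (R₀ : ℝ) = (2 * (M * D)) * (4 ^ R₀ * (R₀ : ℝ)) := by ring
    rw [e1, e2]
    refine mul_le_mul_of_nonneg_left ?_ (by positivity)
    exact mul_le_mul h4 hsR' (by positivity) (by positivity)
  have hηle : 2 * 4 ^ (s + 1) * M * D * (s + 1) * ((ρ' - 1) / L) ≤ 2 * ηB * L ^ (-(A₀ + 1)) := by
    calc 2 * 4 ^ (s + 1) * M * D * (s + 1) * ((ρ' - 1) / L) ≤ ηB * ((ρ' - 1) / L) :=
          mul_le_mul_of_nonneg_right hcoef hfrac0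
      _ ≤ ηB * (2 * L ^ (-A₀) / L) := mul_le_mul_of_nonneg_left hfrac (by positivity)
      _ = 2 * ηB * L ^ (-(A₀ + 1)) := by rw [mul_div_assoc, hLA₀1]; ring
  have hLsmall : 2 * ηB * L ^ (-(A₀ + 1)) ≤ 1 := by
    have hpos : 0 < L ^ (A₀ + 1) := Real.rpow_pos_of_pos hL _
    rw [Real.rpow_neg hL.le, ← div_eq_mul_inv, div_le_one hpos]
    linarith
  exact ⟨mul_nonneg (by positivity) hfrac0, hηle.trans hLsmall, hηle⟩

/-- Term (a): the main terms of the relevant tuples. [folklore] -/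
theorem term_a_le {Cw η CS x L A A₀ sumS Relcard J : ℝ} {R₀ : ℕ} (hCw : 0 ≤ Cw) (hη1 : η ≤ 1)
    (hCS : 0 ≤ CS) (hx : 0 ≤ x) (hL : 1 ≤ L) (hsum0 : 0 ≤ sumS)
    (hsum : sumS ≤ Relcard * (CS * (x / L ^ (A + (A₀ + 1) * R₀))))
    (hRel : Relcard ≤ (J + 1) ^ R₀) (hJ1 : 1 ≤ J + 1) (hJ : J + 1 ≤ 5 * L ^ (A₀ + 1)) :
    (Cw + η) * sumS ≤ (Cw + 1) * 5 ^ R₀ * CS * (x / L ^ A) := by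
  have hL0 : 0 < L := by linarith
  have hJpow : (J + 1) ^ R₀ ≤ 5 ^ R₀ * L ^ ((A₀ + 1) * R₀) := by
    calc (J + 1) ^ R₀ ≤ (5 * L ^ (A₀ + 1)) ^ R₀ := pow_le_pow_left₀ (by linarith) hJ R₀
      _ = 5 ^ R₀ * L ^ ((A₀ + 1) * R₀) := by
          rw [mul_pow, ← Real.rpow_natCast (L ^ (A₀ + 1)) R₀, ← Real.rpow_mul hL0.le]
  have hexpA : x / L ^ (A + (A₀ + 1) * R₀) * L ^ ((A₀ + 1) * R₀) = x / L ^ A := by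
    rw [Real.rpow_add hL0, div_mul_eq_mul_div, mul_div_mul_right _ _ (Real.rpow_pos_of_pos hL0 _).ne']
  have hxA' : 0 ≤ x / L ^ (A + (A₀ + 1) * R₀) := div_nonneg hx (Real.rpow_nonneg hL0.le _)
  calc (Cw + η) * sumS ≤ (Cw + 1) * (Relcard * (CS * (x / L ^ (A + (A₀ + 1) * R₀)))) :=
        mul_le_mul (by linarith) hsum hsum0 (by positivity)
    _ ≤ (Cw + 1) * ((5 ^ R₀ * L ^ ((A₀ + 1) * R₀)) * (CS * (x / L ^ (A + (A₀ + 1) * R₀)))) := by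
        refine mul_le_mul_of_nonneg_left (mul_le_mul_of_nonneg_right (hRel.trans hJpow) ?_) (by positivity)
        positivity
    _ = (Cw + 1) * 5 ^ R₀ * CS * (x / L ^ (A + (A₀ + 1) * R₀) * L ^ ((A₀ + 1) * R₀)) := by ring
    _ = (Cw + 1) * 5 ^ R₀ * CS * (x / L ^ A) := by rw [hexpA]

/-- Term (b): the `ℓ¹` error of the good tuples. [folklore] -/
theorem term_b_le {Φ η ηB x L A X₂ : ℝ} {R₀ s : ℕ} (hΦ : Φ ≤ 4 * L ^ 2) (hη0 : 0 ≤ η)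
    (hη : η ≤ 2 * ηB * L ^ (-((A + 3) + 1))) (hηB : 0 ≤ ηB) (hsR : (s : ℝ) + 1 ≤ R₀) (hX₂0 : 0 ≤ X₂)
    (hX₂ : X₂ ≤ 3 * x) (hx : 0 ≤ x) (hL : 1 ≤ L) :
    2 * Φ * (η * ((s + 1) * X₂)) ≤ 48 * ηB * R₀ * (x / L ^ A) := by
  have hL0 : 0 < L := by linarith
  have hexpB : L ^ 2 * L ^ (-((A + 3) + 1)) ≤ L ^ (-A) := by
    rw [← Real.rpow_natCast L 2, ← Real.rpow_add hL0]
    refine Real.rpow_le_rpow_of_exponent_le hL ?_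
    push_cast; linarith
  have hxLA : x / L ^ A = x * L ^ (-A) := by rw [Real.rpow_neg hL0.le, div_eq_mul_inv]
  have h1 : (s + 1) * X₂ ≤ R₀ * (3 * x) := mul_le_mul hsR hX₂ hX₂0 (by positivity)
  calc 2 * Φ * (η * ((s + 1) * X₂))
      ≤ 2 * (4 * L ^ 2) * ((2 * ηB * L ^ (-((A + 3) + 1))) * (R₀ * (3 * x))) := by
        refine mul_le_mul (mul_le_mul_of_nonneg_left hΦ (by norm_num)) (mul_le_mul hη h1 (by positivity)
          (by positivity)) (by positivity) (by positivity)
    _ = 48 * ηB * R₀ * x * (L ^ 2 * L ^ (-((A + 3) + 1))) := by ring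
    _ ≤ 48 * ηB * R₀ * x * L ^ (-A) := mul_le_mul_of_nonneg_left hexpB (by positivity)
    _ = 48 * ηB * R₀ * (x / L ^ A) := by rw [hxLA]; ring

/-- The exceptional count: `#E ≤ (60 + 24 R₀) P x L^{1-A₀} + 2`. [folklore] -/
theorem excCount_le {Ecard E1 E2 E3 J ρ' L A₀ x X₁ X₂ T P : ℝ} {R₀ s : ℕ}
    (hsplit : Ecard ≤ E1 + E2 + E3) (hE1 : E1 ≤ (J + 1) * (ρ' - 1) ^ 2 * T)
    (hE2 : E2 ≤ 2 * (ρ' ^ (s + 1) - 1) * X₁ + 1) (hE3 : E3 ≤ 2 * (ρ' ^ (s + 1) - 1) * X₂ + 1)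
    (hJ : J + 1 ≤ 5 * L ^ (A₀ + 1)) (hρ'1 : 1 ≤ ρ') (hρ' : ρ' - 1 ≤ 2 * L ^ (-A₀))
    (hρ''P : ρ' ^ (s + 1) ≤ P) (hP : 1 ≤ P) (hsR : (s : ℝ) + 1 ≤ R₀)
    (hT0 : 0 ≤ T) (hT : T ≤ P * (3 * x)) (hX₁0 : 0 ≤ X₁) (hX₁ : X₁ ≤ 3 * x) (hX₂0 : 0 ≤ X₂) (hX₂ : X₂ ≤ 3 * x)
    (hx : 0 ≤ x) (hL : 1 ≤ L) :
    Ecard ≤ (60 + 24 * R₀) * P * (x * L ^ (1 - A₀)) + 2 := by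
  have hL0 : 0 < L := by linarith
  have hLA₀0 : 0 ≤ L ^ (-A₀) := Real.rpow_nonneg hL0.le _
  have hexpD : L ^ (-A₀) ≤ L ^ (1 - A₀) := Real.rpow_le_rpow_of_exponent_le hL (by linarith)
  have hexpE : L ^ (A₀ + 1) * (L ^ (-A₀)) ^ 2 = L ^ (1 - A₀) := by
    rw [← Real.rpow_natCast (L ^ (-A₀)) 2, ← Real.rpow_mul hL0.le, ← Real.rpow_add hL0]
    congr 1; push_cast; ring
  have hρ''1 : 1 ≤ ρ' ^ (s + 1) := one_le_pow₀ hρ'1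
  have hρ''sub : ρ' ^ (s + 1) - 1 ≤ R₀ * P * (2 * L ^ (-A₀)) := by
    calc ρ' ^ (s + 1) - 1 ≤ (s + 1 : ℕ) * ρ' ^ (s + 1) * (ρ' - 1) := pow_sub_one_le_mul hρ'1 (s + 1)
      _ ≤ R₀ * P * (2 * L ^ (-A₀)) := by
          push_cast
          exact mul_le_mul (mul_le_mul hsR hρ''P (by positivity) (by positivity)) hρ' (by linarith)
            (by positivity)
  have h1 : (J + 1) * (ρ' - 1) ^ 2 * T ≤ 60 * P * (x * L ^ (1 - A₀)) := by
    calc (J + 1) * (ρ' - 1) ^ 2 * T ≤ (5 * L ^ (A₀ + 1)) * (2 * L ^ (-A₀)) ^ 2 * (P * (3 * x)) := by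
          refine mul_le_mul (mul_le_mul hJ (pow_le_pow_left₀ (by linarith) hρ' 2) (sq_nonneg _)
            (by positivity)) hT hT0 (by positivity)
      _ = 60 * P * x * (L ^ (A₀ + 1) * (L ^ (-A₀)) ^ 2) := by ring
      _ = 60 * P * (x * L ^ (1 - A₀)) := by rw [hexpE]; ring
  have h2 : ∀ X : ℝ, 0 ≤ X → X ≤ 3 * x →
      2 * (ρ' ^ (s + 1) - 1) * X + 1 ≤ 12 * R₀ * P * (x * L ^ (1 - A₀)) + 1 := by
    intro X hX0 hX3
    have h := mul_le_mul hρ''sub hX3 hX0 (by positivity)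
    have h' : L ^ (-A₀) * x ≤ x * L ^ (1 - A₀) := by
      rw [mul_comm]; exact mul_le_mul_of_nonneg_left hexpD hx
    have hR0 : (0 : ℝ) ≤ R₀ * P := by positivity
    nlinarith [mul_le_mul_of_nonneg_left h' hR0]
  have h2a := h2 X₁ hX₁0 hX₁
  have h2b := h2 X₂ hX₂0 hX₂
  have : (60 + 24 * R₀) * P * (x * L ^ (1 - A₀)) = 60 * P * (x * L ^ (1 - A₀)) +
      12 * R₀ * P * (x * L ^ (1 - A₀)) + 12 * R₀ * P * (x * L ^ (1 - A₀)) := by ring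
  linarith

/-- Term (c): the `ℓ¹` error of the bad tuples. [folklore] -/
theorem term_c_le {Φ Cw Ecard x L A P : ℝ} {R₀ s : ℕ} (hΦ : Φ ≤ 4 * L ^ 2) (hCw : 0 ≤ Cw)
    (hsR : (s : ℝ) + 1 ≤ R₀) (hE0 : 0 ≤ Ecard)
    (hE : Ecard ≤ (60 + 24 * R₀) * P * (x * L ^ (1 - (A + 3))) + 2) (hL : 1 ≤ L) :
    2 * Φ * (Cw * ((s + 1) * Ecard)) ≤
      8 * Cw * R₀ * ((60 + 24 * R₀) * P) * (x / L ^ A) + 16 * Cw * R₀ * L ^ 2 := by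
  have hL0 : 0 < L := by linarith
  have hexpC : L ^ 2 * L ^ (1 - (A + 3)) = L ^ (-A) := by
    rw [← Real.rpow_natCast L 2, ← Real.rpow_add hL0]; congr 1; push_cast; ring
  have hxLA : x / L ^ A = x * L ^ (-A) := by rw [Real.rpow_neg hL0.le, div_eq_mul_inv]
  have h1 : (s + 1) * Ecard ≤ R₀ * ((60 + 24 * R₀) * P * (x * L ^ (1 - (A + 3))) + 2) :=
    mul_le_mul hsR hE hE0 (by positivity)
  calc 2 * Φ * (Cw * ((s + 1) * Ecard))
      ≤ 2 * (4 * L ^ 2) * (Cw * (R₀ * ((60 + 24 * R₀) * P * (x * L ^ (1 - (A + 3))) + 2))) := by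
        refine mul_le_mul (mul_le_mul_of_nonneg_left hΦ (by norm_num))
          (mul_le_mul_of_nonneg_left h1 hCw) (by positivity) (by positivity)
    _ = 8 * Cw * R₀ * ((60 + 24 * R₀) * P) * x * (L ^ 2 * L ^ (1 - (A + 3))) + 16 * Cw * R₀ * L ^ 2 := by ring
    _ = 8 * Cw * R₀ * ((60 + 24 * R₀) * P) * (x / L ^ A) + 16 * Cw * R₀ * L ^ 2 := by rw [hexpC, hxLA]; ring

end Numeric

/-! ### The level of distribution of the truncated inner sequence -/

section Main

/-- **Bound (local) of §4.5.**  Assume `GEH[ϑ]` for all `0 < ϑ < 1`.  Let `F, G` be differentiable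
with `|F|, |G| ≤ M` and `|F'|, |G'| ≤ D`, `0 < ε ≤ 1/2`, `h₀ ∈ ℤ`, `0 < θ < 1`, `A > 0`.  Then
`Σ_{q ≤ x^θ} sup_{a ∈ (ℤ/qℤ)^×} |Δ(1_{(X₁,X₂]} λ_F λ_G 1_{p(·) > x^ε}; a (q))| = O(x / log^A x)`,
`X₁ = ⌈x⌉ + h₀ - 1`, `X₂ = ⌊2x⌋ + h₀`. [cite: Polymath8b2014, §4.5, p. 17, (local)] -/
theorem isBigO_sum_iSup_apDiscrepancy_wTrunc
    (hGEH : ∀ ϑ : ℝ, 0 < ϑ → ϑ < 1 → GeneralizedElliottHalberstam ϑ)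
    {F G : ℝ → ℝ} (hFd : Differentiable ℝ F) (hGd : Differentiable ℝ G) {M D : ℝ}
    (hMF : ∀ t, |F t| ≤ M) (hMG : ∀ t, |G t| ≤ M) (hDF : ∀ t, |deriv F t| ≤ D) (hDG : ∀ t, |deriv G t| ≤ D)
    {ε : ℝ} (hε : 0 < ε) (hε1 : ε ≤ 1 / 2) (h₀ : ℤ) {θ : ℝ} (hθ0 : 0 < θ) (hθ1 : θ < 1)
    {A : ℝ} (hA : 0 < A) :
    (fun x : ℝ => ∑ q ∈ Icc 1 ⌊x ^ θ⌋₊, (⨆ a : (ZMod q)ˣ,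
        |apDiscrepancy (fun n => if thetaX1 h₀ x < n then wTrunc F G ε x n else 0) (thetaX2 h₀ x) q a|))
      =O[atTop] fun x : ℝ => x / Real.log x ^ A := by
  have hM0 : 0 ≤ M := (abs_nonneg _).trans (hMF 0)
  have hD0 : 0 ≤ D := (abs_nonneg _).trans (hDF 0)
  -- constants
  set R₀ : ℕ := ⌊1 / ε⌋₊ + 1 with hR₀
  set A₀ : ℝ := A + 3 with hA₀def
  have hA₀2 : 2 ≤ A₀ := by rw [hA₀def]; linarith
  have hA'0 : 0 < A + (A₀ + 1) * R₀ := by positivity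
  set Cw : ℝ := 4 ^ R₀ * M ^ 2 with hCwdef
  have hCw0 : 0 ≤ Cw := by positivity
  set ηB : ℝ := 2 * 4 ^ R₀ * M * D * R₀ with hηBdef
  have hηB0 : 0 ≤ ηB := by positivity
  set P : ℝ := (5 / 2) ^ R₀ with hPdef
  have hP1 : 1 ≤ P := one_le_pow₀ (by norm_num)
  -- the level inputs
  have hlev : ∀ s ∈ Finset.range R₀, ∃ C : ℝ, ∀ᶠ x : ℝ in atTop, ∀ τ ∈ relTuples ε A₀ h₀ x s,
      ∑ q ∈ Icc 1 ⌊x ^ θ⌋₊, (⨆ a : (ZMod q)ˣ,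
        |apDiscrepancy (tupleConv (gridAt ε A₀ x) τ) (boxTop ε A₀ x τ) q a|) ≤
        C * (x / Real.log x ^ (A + (A₀ + 1) * R₀)) := by
    intro s _
    rcases Nat.eq_zero_or_pos s with rfl | hs1
    · exact eh_bound_rel0 hGEH hA₀2 h₀ hθ1 hA'0
    · exact geh_bound_rel (hGEH θ hθ0 hθ1) hε hε1 hA₀2 h₀ hs1 hA'0
  choose! Cs hCs using hlev
  set CS : ℝ := ∑ s ∈ Finset.range R₀, max (Cs s) 0 with hCSdef
  have hCS0 : 0 ≤ CS := Finset.sum_nonneg fun s _ => le_max_right _ _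
  have hCsle : ∀ s ∈ Finset.range R₀, Cs s ≤ CS := fun s hs =>
    (le_max_left _ _).trans (Finset.single_le_sum (f := fun s => max (Cs s) 0) (fun _ _ => le_max_right _ _) hs)
  have hlevall := (Filter.eventually_all_finset (Finset.range R₀)).2 hCs
  -- the final constants
  set Ka : ℝ := (Cw + 1) * 5 ^ R₀ * CS with hKa
  set Kb : ℝ := 48 * ηB * R₀ with hKb
  set Kc : ℝ := 8 * Cw * R₀ * ((60 + 24 * R₀) * P) with hKc
  set Kd : ℝ := 16 * Cw * R₀ with hKd
  -- eventual facts
  have hlogt : Tendsto (fun x : ℝ => Real.log x ^ (A₀ + 1)) atTop atTop :=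
    (tendsto_rpow_atTop (by linarith)).comp Real.tendsto_log_atTop
  have e_small : ∀ᶠ x : ℝ in atTop, 2 * ηB + 1 ≤ Real.log x ^ (A₀ + 1) := hlogt.eventually_ge_atTop _
  have e_L2 : ∀ᶠ x : ℝ in atTop, (R₀ * Kd) * Real.log x ^ (A + 2) ≤ x ^ (1 : ℝ) :=
    eventually_mul_log_rpow_le_rpow one_pos (A + 2) (R₀ * Kd)
  refine IsBigO.of_bound (R₀ * (Ka + Kb + Kc) + 1) ?_
  filter_upwards [hlevall, eventually_rho'_sub_one_le hε hA₀2, eventually_gridJ_add_one_le (by linarith : 0 ≤ A₀),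
    eventually_power_facts hε hε1, eventually_ge_atTop (4 : ℝ), eventually_ge_atTop ((h₀.natAbs : ℝ) + 2),
    eventually_ge_atTop (Real.exp 2), e_small, e_L2] with x hxlev hρ' hJ hpow hx4 hxh hxe2 hsmall hL2
  obtain ⟨hxε3, -, -, -, -, -, -, -, -⟩ := hpow
  have hx0 : 0 < x := by linarith
  have hx1 : 1 ≤ x := by linarith
  have hlog2 : 2 ≤ Real.log x := by rwa [Real.le_log_iff_exp_le hx0]
  set L := Real.log x with hLdef
  have hL1 : 1 ≤ L := by linarith
  have hL0 : 0 < L := by linarith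
  obtain ⟨-, hX₁₂, hX₂3⟩ := thetaX_sizes h₀ hxh
  set X₁ := thetaX1 h₀ x
  set X₂ := thetaX2 h₀ x
  set c := gridAt ε A₀ x with hcdef
  set J := gridJ A₀ x with hJdef
  set Q := ⌊x ^ θ⌋₊ with hQdef
  set ρ' : ℝ := gridRho A₀ x * (1 + 2 / x ^ ε) with hρ'def
  have hρ'1 : 1 ≤ ρ' := by
    have h1 := (one_lt_gridRho A₀ x).le
    have h2 : (1 : ℝ) ≤ 1 + 2 / x ^ ε := by
      have := div_nonneg (by norm_num : (0 : ℝ) ≤ 2) (Real.rpow_nonneg hx0.le ε); linarith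
    rw [hρ'def]; nlinarith
  have hρ'52 : ρ' ≤ 5 / 2 := by
    have h1 := gridRho_le hA₀2 x
    have h2 : 2 / x ^ ε ≤ 1 := by rw [div_le_one (by positivity)]; linarith
    have h3 : (0 : ℝ) ≤ 1 + 2 / x ^ ε := by
      have := div_nonneg (by norm_num : (0 : ℝ) ≤ 2) (Real.rpow_nonneg hx0.le ε); linarith
    rw [hρ'def]
    calc gridRho A₀ x * (1 + 2 / x ^ ε) ≤ 5 / 4 * 2 := mul_le_mul h1 (by linarith) h3 (by norm_num)
      _ = 5 / 2 := by norm_num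
  have hX₁3 : (X₁ : ℝ) ≤ 3 * x := le_trans (by exact_mod_cast hX₁₂) hX₂3
  have hJ1 : (1 : ℝ) ≤ (J : ℝ) + 1 := by have : (0 : ℝ) ≤ J := Nat.cast_nonneg _; linarith
  -- `Φ ≤ 4 L²`
  set Φ : ℝ := ∑ q ∈ Icc 1 Q, (1 : ℝ) / Nat.totient q with hΦdef
  have hΦ : Φ ≤ 4 * L ^ 2 := by
    have hQx : (Q : ℝ) ≤ x := by
      calc (Q : ℝ) ≤ x ^ θ := Nat.floor_le (Real.rpow_nonneg hx0.le θ)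
        _ ≤ x ^ (1 : ℝ) := Real.rpow_le_rpow_of_exponent_le hx1 hθ1.le
        _ = x := Real.rpow_one x
    have hlogQ : Real.log Q ≤ L := by
      rcases Nat.eq_zero_or_pos Q with hQ0 | hQpos
      · rw [hQ0, Nat.cast_zero, Real.log_zero]; exact hL0.le
      · exact Real.log_le_log (by exact_mod_cast hQpos) hQx
    have hlogQ0 : 0 ≤ Real.log Q := Real.log_natCast_nonneg Q
    exact sum_inv_totient_le (by linarith) (by linarith)
  -- norms
  have hT0 : 0 ≤ ∑ q ∈ Icc 1 Q, (⨆ a : (ZMod q)ˣ,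
      |apDiscrepancy (fun n => if X₁ < n then wTrunc F G ε x n else 0) X₂ q a|) :=
    Finset.sum_nonneg fun q _ => Real.iSup_nonneg fun _ => abs_nonneg _
  have hLA : 0 < L ^ A := Real.rpow_pos_of_pos hL0 A
  have hxLA : 0 ≤ x / L ^ A := div_nonneg hx0.le hLA.le
  rw [Real.norm_of_nonneg hT0, Real.norm_of_nonneg hxLA]
  -- Step 1: the windowed sequence
  have hwin : ∀ q (a : (ZMod q)ˣ), apDiscrepancy (fun n => if X₁ < n then wTrunc F G ε x n else 0) X₂ q a =
      apDiscrepancy (winSeq F G ε h₀ x) X₂ q a := by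
    intro q a
    refine apDiscrepancy_congr (fun n hn => ?_) q a
    have hn2 : n ≤ X₂ := (Finset.mem_Icc.1 hn).2
    by_cases h1 : X₁ < n
    · rw [if_pos h1, winSeq, if_pos ⟨h1, hn2⟩]
    · rw [if_neg h1, winSeq, if_neg (fun h => h1 h.1)]
  simp only [hwin]
  -- Step 2: decomposition into pieces and the per-order totals
  have hstep2 := sum_iSup_winSeq_le_sum_pieces (A₀ := A₀) hMF hMG hε hx4 hxε3 hxh Q
  have htot : ∀ s ∈ Finset.range R₀,
      ∑ τ ∈ monoTuples (s + 1) J, ∑ q ∈ Icc 1 Q,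
        (⨆ a : (ZMod q)ˣ, |apDiscrepancy (pieceSeq F G ε A₀ h₀ x τ) X₂ q a|) ≤
        (Ka + Kb + Kc) * (x / L ^ A) + Kd * L ^ 2 := by
    intro s hs
    have hsR : s + 1 ≤ R₀ := by have := Finset.mem_range.1 hs; omega
    have hsR' : (s : ℝ) + 1 ≤ R₀ := by exact_mod_cast hsR
    have h := sum_pieces_le_total hFd hGd hMF hMG hDF hDG hε hx4 hxε3 hxh (A₀ := A₀) hsR Q
    obtain ⟨hη0, hη1, hηA⟩ := eta_bounds (A₀ := A₀) hM0 hD0 hL0 hsR hρ'1 hρ' hsmall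
    -- (a)
    have hsum0 : 0 ≤ ∑ τ ∈ relTuples ε A₀ h₀ x s, ∑ q ∈ Icc 1 Q,
        (⨆ a : (ZMod q)ˣ, |apDiscrepancy (tupleConv c τ) (boxTop ε A₀ x τ) q a|) :=
      Finset.sum_nonneg fun τ _ => Finset.sum_nonneg fun q _ => Real.iSup_nonneg fun _ => abs_nonneg _
    have hsum : ∑ τ ∈ relTuples ε A₀ h₀ x s, ∑ q ∈ Icc 1 Q,
        (⨆ a : (ZMod q)ˣ, |apDiscrepancy (tupleConv c τ) (boxTop ε A₀ x τ) q a|) ≤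
        (relTuples ε A₀ h₀ x s).card * (CS * (x / L ^ (A + (A₀ + 1) * R₀))) := by
      have hSle : ∀ τ ∈ relTuples ε A₀ h₀ x s, ∑ q ∈ Icc 1 Q,
          (⨆ a : (ZMod q)ˣ, |apDiscrepancy (tupleConv c τ) (boxTop ε A₀ x τ) q a|) ≤
          CS * (x / L ^ (A + (A₀ + 1) * R₀)) := fun τ hτ =>
        (hxlev s hs τ hτ).trans (mul_le_mul_of_nonneg_right (hCsle s hs)
          (div_nonneg hx0.le (Real.rpow_nonneg hL0.le _)))
      have := Finset.sum_le_sum hSle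
      rwa [Finset.sum_const, nsmul_eq_mul] at this
    have hRelcard : ((relTuples ε A₀ h₀ x s).card : ℝ) ≤ ((J : ℝ) + 1) ^ R₀ := by
      have h1 : (relTuples ε A₀ h₀ x s).card ≤ (J + 1) ^ (s + 1) :=
        (Finset.card_le_card (relTuples_subset s)).trans (card_monoTuples_le _ _)
      calc ((relTuples ε A₀ h₀ x s).card : ℝ) ≤ ((J : ℝ) + 1) ^ (s + 1) := by exact_mod_cast h1
        _ ≤ ((J : ℝ) + 1) ^ R₀ := pow_le_pow_right₀ hJ1 hsR
    have ha := term_a_le hCw0 hη1 hCS0 hx0.le hL1 hsum0 hsum hRelcard hJ1 hJ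
    -- (b)
    have hb := term_b_le (A := A) (s := s) hΦ hη0 hηA hηB0 hsR' (Nat.cast_nonneg X₂) hX₂3 hx0.le hL1
    -- (c)
    have hρ''1 : 1 ≤ ρ' ^ (s + 1) := one_le_pow₀ hρ'1
    have hρ''P : ρ' ^ (s + 1) ≤ P := by
      calc ρ' ^ (s + 1) ≤ (5 / 2) ^ (s + 1) := pow_le_pow_left₀ (by linarith) hρ'52 _
        _ ≤ (5 / 2) ^ R₀ := pow_le_pow_right₀ (by norm_num) hsR
    have hsplit := card_filter_or_or_le (Icc 1 ⌊ρ' ^ (s + 1) * (X₂ : ℝ)⌋₊)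
      (fun n => ∃ j p p', j ≤ J ∧ p.Prime ∧ p'.Prime ∧ c j < p ∧ p ≤ p' ∧ p' ≤ c (j + 1) ∧ p * p' ∣ n)
      (fun n : ℕ => (X₁ : ℝ) / ρ' ^ (s + 1) < n ∧ (n : ℝ) < ρ' ^ (s + 1) * X₁)
      (fun n : ℕ => (X₂ : ℝ) / ρ' ^ (s + 1) < n ∧ (n : ℝ) < ρ' ^ (s + 1) * X₂)
    have hE1 := card_closePrimes_le c J ⌊ρ' ^ (s + 1) * (X₂ : ℝ)⌋₊ hρ'1
      (fun j => le_trans (by norm_num) (three_le_gridAt ε A₀ x j)) (fun j _ => gridAt_succ_le_ratio hx0 hxε3 j)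
    have hE2 := card_near_le ⌊ρ' ^ (s + 1) * (X₂ : ℝ)⌋₊ (X := (X₁ : ℝ)) (Nat.cast_nonneg _) hρ''1
    have hE3 := card_near_le ⌊ρ' ^ (s + 1) * (X₂ : ℝ)⌋₊ (X := (X₂ : ℝ)) (Nat.cast_nonneg _) hρ''1
    have hT : (⌊ρ' ^ (s + 1) * (X₂ : ℝ)⌋₊ : ℝ) ≤ P * (3 * x) :=
      (Nat.floor_le (by positivity)).trans (mul_le_mul hρ''P hX₂3 (Nat.cast_nonneg _) (by positivity))
    have hcast : ((excSet ε A₀ h₀ x s).card : ℝ) ≤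
        (((Icc 1 ⌊ρ' ^ (s + 1) * (X₂ : ℝ)⌋₊).filter fun n =>
            ∃ j p p', j ≤ J ∧ p.Prime ∧ p'.Prime ∧ c j < p ∧ p ≤ p' ∧ p' ≤ c (j + 1) ∧ p * p' ∣ n).card : ℝ) +
          (((Icc 1 ⌊ρ' ^ (s + 1) * (X₂ : ℝ)⌋₊).filter fun n : ℕ =>
            (X₁ : ℝ) / ρ' ^ (s + 1) < n ∧ (n : ℝ) < ρ' ^ (s + 1) * X₁).card : ℝ) +
          (((Icc 1 ⌊ρ' ^ (s + 1) * (X₂ : ℝ)⌋₊).filter fun n : ℕ =>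
            (X₂ : ℝ) / ρ' ^ (s + 1) < n ∧ (n : ℝ) < ρ' ^ (s + 1) * X₂).card : ℝ) := by
      rw [excSet]
      exact_mod_cast hsplit
    have hEcard := excCount_le hcast hE1 hE2 hE3 hJ hρ'1 hρ' hρ''P hP1 hsR'
      (Nat.cast_nonneg _) hT (Nat.cast_nonneg _) hX₁3 (Nat.cast_nonneg _) hX₂3 hx0.le hL1
    have hc := term_c_le (A := A) (s := s) hΦ hCw0 hsR' (Nat.cast_nonneg _) hEcard hL1
    -- combine
    calc _ ≤ _ := h
      _ ≤ Ka * (x / L ^ A) + (Kb * (x / L ^ A) + (Kc * (x / L ^ A) + Kd * L ^ 2)) := by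
          rw [mul_add (2 * Φ)]
          exact add_le_add ha (add_le_add hb hc)
      _ = (Ka + Kb + Kc) * (x / L ^ A) + Kd * L ^ 2 := by ring
  -- Step 3: sum over the orders
  have hL2x : R₀ * Kd * L ^ 2 ≤ x / L ^ A := by
    rw [le_div_iff₀ hLA]
    have h1 : R₀ * Kd * L ^ 2 * L ^ A = (R₀ * Kd) * L ^ (A + 2) := by
      rw [← Real.rpow_natCast L 2, mul_assoc, ← Real.rpow_add hL0]; push_cast; ring_nf
    rw [h1]
    calc (R₀ : ℝ) * Kd * L ^ (A + 2) ≤ x ^ (1 : ℝ) := hL2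
      _ = x := Real.rpow_one x
  calc ∑ q ∈ Icc 1 Q, (⨆ a : (ZMod q)ˣ, |apDiscrepancy (winSeq F G ε h₀ x) X₂ q a|)
      ≤ ∑ s ∈ Finset.range R₀, ∑ τ ∈ monoTuples (s + 1) J, ∑ q ∈ Icc 1 Q,
          (⨆ a : (ZMod q)ˣ, |apDiscrepancy (pieceSeq F G ε A₀ h₀ x τ) X₂ q a|) := hstep2
    _ ≤ ∑ s ∈ Finset.range R₀, ((Ka + Kb + Kc) * (x / L ^ A) + Kd * L ^ 2) := Finset.sum_le_sum htot
    _ = R₀ * ((Ka + Kb + Kc) * (x / L ^ A)) + R₀ * Kd * L ^ 2 := by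
        rw [Finset.sum_const, Finset.card_range, nsmul_eq_mul]; ring
    _ ≤ R₀ * ((Ka + Kb + Kc) * (x / L ^ A)) + x / L ^ A := add_le_add le_rfl hL2x
    _ = (R₀ * (Ka + Kb + Kc) + 1) * (x / L ^ A) := by ring

end Main

end Literature.NumberTheory.Sieve
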